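import Mathlib
import Literature.Analysis.SpecialFunctions.BesselHeatKernelApproxIdentity
import HarnessLib

/-!
# Approximate identity for the radial heat kernels against polynomially bounded test functions

Variant of `tendsto_integral_besselHeatKernel_approx` (`BesselHeatKernelApproxIdentity.lean`) in which the test function `G`
is only required to satisfy `|G(τ,z)| ≤ M (1 + z^p)` (`p ≥ 0`) instead of a uniform bound:
`∫_0^∞ q^{(ν)}_τ(x,z) G(τ,z) z dz → L` as `τ → 0⁺` whenever `G(τ,z) → L` as `(τ,z) → (0⁺,x)`
(`tendsto_integral_besselHeatKernel_approx_of_le_rpow`).  The extra growth is absorbed by the concentration estimate with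
weight `z^{p+1}` (`tendsto_setIntegral_besselHeatKernel_far`).  This is the form needed when `G` is itself a radial heat
kernel `q^{(κ)}_σ(y,·) ≤ C z^κ` (Duhamel comparison of kernels of different index) [RevuzYor1999, Ch. XI §1].

## References
* D. Revuz, M. Yor, *Continuous Martingales and Brownian Motion*, 3rd ed. (1999), Ch. XI §1. [RevuzYor1999]
-/

noncomputable section

open Filter Topology Real MeasureTheory Set
open scoped Nat BigOperators

namespace Literature.Analysis.SpecialFunctions

variable {ν x : ℝ}

/-- **Approximate identity, polynomially bounded test functions**: if `|G(τ,z)| ≤ M(1+z^p)` on `(0,∞)`, `G(τ,·)` measurable,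
and `G(τ,z) → L` as `(τ,z) → (0⁺,x)`, then `∫_0^∞ q^{(ν)}_τ(x,z) G(τ,z) z dz → L` as `τ → 0⁺` (`ν ≥ 0`, `x > 0`).
[cite: RevuzYor1999, Ch. XI §1] -/
theorem tendsto_integral_besselHeatKernel_approx_of_le_rpow (hν : 0 ≤ ν) (hx : 0 < x) {G : ℝ → ℝ → ℝ}
    {L M p : ℝ} (hp : 0 ≤ p)
    (hGm : ∀ τ, 0 < τ → AEStronglyMeasurable (G τ) (volume.restrict (Ioi 0)))
    (hGb : ∀ τ z, 0 < τ → 0 < z → |G τ z| ≤ M * (1 + z ^ p))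
    (hGc : ∀ ε > 0, ∃ δ > 0, ∀ τ z, 0 < τ → τ < δ → 0 < z → |z - x| < δ → |G τ z - L| < ε) :
    Tendsto (fun τ : ℝ => ∫ z in Ioi (0 : ℝ), besselHeatKernel ν τ x z * G τ z * z) (𝓝[>] 0) (𝓝 L) := by
  have hM : 0 ≤ M := by
    have h := (abs_nonneg _).trans (hGb 1 1 one_pos one_pos)
    rw [Real.one_rpow] at h
    linarith
  have hmass := tendsto_integral_besselHeatKernel_mass hν hx
  rw [Metric.tendsto_nhds]
  intro ε hε
  set η : ℝ := min (ε / (4 * (M + |L| + 1))) 1 with hη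
  have hηpos : 0 < η := by positivity
  have hηε : η ≤ ε / (4 * (M + |L| + 1)) := min_le_left _ _
  have hη1 : η ≤ 1 := min_le_right _ _
  obtain ⟨δ, hδ, hG⟩ := hGc η hηpos
  set F : Set ℝ := {z : ℝ | 0 < z ∧ δ ≤ |z - x|} with hF_def
  have hFm : MeasurableSet F :=
    (measurableSet_lt measurable_const measurable_id).inter
      (measurableSet_le measurable_const ((measurable_id.sub measurable_const).abs))
  have hFsub : F ⊆ Ioi 0 := fun z hz => hz.1
  have hev1 : ∀ᶠ τ in 𝓝[>] (0 : ℝ), |∫ z in F, besselHeatKernel ν τ x z * z| < η := by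
    have := (Metric.tendsto_nhds.1 (tendsto_setIntegral_besselHeatKernel_far_one hν hx hδ)) η hηpos
    simpa [Real.dist_eq] using this
  have hev1' : ∀ᶠ τ in 𝓝[>] (0 : ℝ), |∫ z in F, besselHeatKernel ν τ x z * z ^ (p + 1)| < η := by
    have := (Metric.tendsto_nhds.1 (tendsto_setIntegral_besselHeatKernel_far hν hx hδ (p := p + 1) (by linarith))) η hηpos
    simpa [Real.dist_eq] using this
  have hev2 : ∀ᶠ τ in 𝓝[>] (0 : ℝ), |(∫ z in Ioi (0 : ℝ), besselHeatKernel ν τ x z * z) - 1| < η := by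
    have := (Metric.tendsto_nhds.1 hmass) η hηpos
    simpa [Real.dist_eq] using this
  have hev3 : Ioo (0 : ℝ) δ ∈ 𝓝[>] (0 : ℝ) := Ioo_mem_nhdsGT hδ
  filter_upwards [hev1, hev1', hev2, hev3] with τ h1 h1' h2 hτ
  have hτ' : 0 < τ := hτ.1
  set K : ℝ → ℝ := fun z => besselHeatKernel ν τ x z with hK_def
  have hKnn : ∀ z, 0 < z → 0 ≤ K z := fun z hz => (besselHeatKernel_pos hν hτ' hx hz).le
  have hI1 : IntegrableOn (fun z => K z * z) (Ioi 0) := integrableOn_besselHeatKernel_mul hν hx hτ'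
  have hIp : IntegrableOn (fun z => K z * z ^ (p + 1)) (Ioi 0) :=
    integrableOn_besselHeatKernel_mul_rpow hν hx hτ' (by linarith)
  -- the polynomial weight `(1 + z^p) (K z * z) = K z * z + K z * z^(p+1)` on `(0,∞)`
  have hIw : IntegrableOn (fun z => (1 + z ^ p) * (K z * z)) (Ioi 0) := by
    have hsum : IntegrableOn (fun z => K z * z + K z * z ^ (p + 1)) (Ioi 0) := hI1.add hIp
    refine hsum.congr_fun (fun z hz => ?_) measurableSet_Ioi
    have hz' : (0 : ℝ) < z := hz
    show K z * z + K z * z ^ (p + 1) = (1 + z ^ p) * (K z * z)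
    rw [Real.rpow_add_one hz'.ne']; ring
  have hIG : IntegrableOn (fun z => K z * G τ z * z) (Ioi 0) := by
    have h : IntegrableOn (fun z => M * ((1 + z ^ p) * (K z * z))) (Ioi 0) := hIw.const_mul M
    refine Integrable.mono' h ?_ ?_
    · exact (((continuous_besselHeatKernel_right hν τ x).aestronglyMeasurable.mul (hGm τ hτ')).mul
        continuous_id.aestronglyMeasurable)
    · refine ae_restrict_of_forall_mem measurableSet_Ioi fun z hz => ?_
      have hz' : (0 : ℝ) < z := hz
      rw [Real.norm_eq_abs, show K z * G τ z * z = G τ z * (K z * z) by ring, abs_mul,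
        abs_of_nonneg (mul_nonneg (hKnn z hz') hz'.le), show M * ((1 + z ^ p) * (K z * z)) = M * (1 + z ^ p) * (K z * z) by ring]
      exact mul_le_mul_of_nonneg_right (hGb τ z hτ' hz') (mul_nonneg (hKnn z hz') hz'.le)
  -- decomposition `∫ K G z - L = ∫ K (G - L) z + L (m - 1)`
  have hdec : (∫ z in Ioi (0 : ℝ), K z * G τ z * z) - L =
      (∫ z in Ioi (0 : ℝ), K z * z * (G τ z - L)) + L * ((∫ z in Ioi (0 : ℝ), K z * z) - 1) := by
    have e : ∫ z in Ioi (0 : ℝ), K z * z * (G τ z - L) =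
        (∫ z in Ioi (0 : ℝ), K z * G τ z * z) - L * ∫ z in Ioi (0 : ℝ), K z * z := by
      rw [← integral_const_mul, ← integral_sub hIG (hI1.const_mul L)]
      refine integral_congr_ae (ae_of_all _ fun z => ?_)
      simp only
      ring
    rw [e]; ring
  -- pointwise bound for the first term
  set g : ℝ → ℝ := fun z => η * (K z * z) +
    F.indicator (fun z => (M + |L|) * (K z * z) + M * (K z * z ^ (p + 1))) z with hg_def
  have hbound : ∀ z ∈ Ioi (0 : ℝ), ‖K z * z * (G τ z - L)‖ ≤ g z := by
    intro z hz
    have hz' : (0 : ℝ) < z := hz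
    have hK0 : 0 ≤ K z := hKnn z hz'
    have hKz : 0 ≤ K z * z := mul_nonneg hK0 hz'.le
    have hzp : 0 ≤ z ^ p := Real.rpow_nonneg hz'.le p
    rw [Real.norm_eq_abs, abs_mul, abs_of_nonneg hKz]
    have hGL : |G τ z - L| ≤ M * (1 + z ^ p) + |L| := (abs_sub _ _).trans (add_le_add (hGb τ z hτ' hz') le_rfl)
    have hind : 0 ≤ F.indicator (fun z => (M + |L|) * (K z * z) + M * (K z * z ^ (p + 1))) z := by
      by_cases hzF : z ∈ F
      · rw [indicator_of_mem hzF]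
        have : 0 ≤ z ^ (p + 1) := Real.rpow_nonneg hz'.le _
        positivity
      · rw [indicator_of_notMem hzF]
    by_cases hzn : |z - x| < δ
    · have hn := hG τ z hτ' hτ.2 hz' hzn
      calc K z * z * |G τ z - L| ≤ K z * z * η := mul_le_mul_of_nonneg_left hn.le hKz
        _ ≤ g z := by rw [hg_def]; linarith
    · have hzF : z ∈ F := ⟨hz', not_lt.1 hzn⟩
      calc K z * z * |G τ z - L| ≤ K z * z * (M * (1 + z ^ p) + |L|) := mul_le_mul_of_nonneg_left hGL hKz
        _ = F.indicator (fun z => (M + |L|) * (K z * z) + M * (K z * z ^ (p + 1))) z := by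
            rw [indicator_of_mem hzF, Real.rpow_add_one hz'.ne']; ring
        _ ≤ g z := by
            rw [hg_def]
            have : 0 ≤ η * (K z * z) := by positivity
            linarith
  have hprod : IntegrableOn (fun z => (M + |L|) * (K z * z) + M * (K z * z ^ (p + 1))) (Ioi 0) :=
    (hI1.const_mul _).add (hIp.const_mul _)
  have hgint : IntegrableOn g (Ioi 0) := by
    rw [hg_def]
    exact (hI1.const_mul η).add (hprod.indicator hFm)
  have hgval : ∫ z in Ioi (0 : ℝ), g z = η * (∫ z in Ioi (0 : ℝ), K z * z) +
      ((M + |L|) * (∫ z in F, K z * z) + M * ∫ z in F, K z * z ^ (p + 1)) := by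
    have hA : ∫ z in Ioi (0 : ℝ), g z = (∫ z in Ioi (0 : ℝ), η * (K z * z)) +
        ∫ z in Ioi (0 : ℝ), F.indicator (fun z => (M + |L|) * (K z * z) + M * (K z * z ^ (p + 1))) z := by
      rw [hg_def]
      exact integral_add (hI1.const_mul η) (hprod.indicator hFm)
    have hB : ∫ z in Ioi (0 : ℝ), F.indicator (fun z => (M + |L|) * (K z * z) + M * (K z * z ^ (p + 1))) z =
        ∫ z in F, ((M + |L|) * (K z * z) + M * (K z * z ^ (p + 1))) := by
      rw [integral_indicator hFm, Measure.restrict_restrict hFm, inter_eq_left.2 hFsub]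
    have hC : ∫ z in F, ((M + |L|) * (K z * z) + M * (K z * z ^ (p + 1))) =
        (M + |L|) * (∫ z in F, K z * z) + M * ∫ z in F, K z * z ^ (p + 1) := by
      have i1 : IntegrableOn (fun z => (M + |L|) * (K z * z)) (Ioi 0) := hI1.const_mul _
      have i2 : IntegrableOn (fun z => M * (K z * z ^ (p + 1))) (Ioi 0) := hIp.const_mul _
      rw [integral_add (i1.mono_set hFsub) (i2.mono_set hFsub), integral_const_mul, integral_const_mul]
    rw [hA, hB, hC, integral_const_mul]
  have hm_le : (∫ z in Ioi (0 : ℝ), K z * z) ≤ 2 := by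
    have := abs_sub_lt_iff.1 h2
    linarith
  have hfirst : |∫ z in Ioi (0 : ℝ), K z * z * (G τ z - L)| ≤ η * 2 + (M + |L|) * η + M * η := by
    calc |∫ z in Ioi (0 : ℝ), K z * z * (G τ z - L)|
        = ‖∫ z in Ioi (0 : ℝ), K z * z * (G τ z - L)‖ := (Real.norm_eq_abs _).symm
      _ ≤ ∫ z in Ioi (0 : ℝ), g z := norm_integral_le_of_norm_le hgint (ae_restrict_of_forall_mem measurableSet_Ioi hbound)
      _ = η * (∫ z in Ioi (0 : ℝ), K z * z) +
          ((M + |L|) * (∫ z in F, K z * z) + M * ∫ z in F, K z * z ^ (p + 1)) := hgval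
      _ ≤ η * 2 + (M + |L|) * η + M * η := by
          have b1 : ∫ z in F, K z * z ≤ η := (le_abs_self _).trans h1.le
          have b2 : ∫ z in F, K z * z ^ (p + 1) ≤ η := (le_abs_self _).trans h1'.le
          nlinarith [abs_nonneg L]
  rw [Real.dist_eq, hdec]
  have hsecond : |L * ((∫ z in Ioi (0 : ℝ), K z * z) - 1)| ≤ |L| * η := by
    rw [abs_mul]; exact mul_le_mul_of_nonneg_left h2.le (abs_nonneg L)
  calc |(∫ z in Ioi (0 : ℝ), K z * z * (G τ z - L)) + L * ((∫ z in Ioi (0 : ℝ), K z * z) - 1)|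
      ≤ |∫ z in Ioi (0 : ℝ), K z * z * (G τ z - L)| + |L * ((∫ z in Ioi (0 : ℝ), K z * z) - 1)| := abs_add_le _ _
    _ ≤ η * 2 + (M + |L|) * η + M * η + |L| * η := add_le_add hfirst hsecond
    _ = η * (2 + 2 * M + 2 * |L|) := by ring
    _ ≤ ε / (4 * (M + |L| + 1)) * (2 + 2 * M + 2 * |L|) :=
        mul_le_mul_of_nonneg_right hηε (by positivity)
    _ < ε := by
        rw [div_mul_eq_mul_div, div_lt_iff₀ (by positivity)]
        nlinarith [abs_nonneg L]


end Literature.Analysis.SpecialFunctions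

end
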